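import Literature.FieldTheory.AlgClosed.AutStableSubspaceDescent
import Mathlib.FieldTheory.AlgebraicClosure
import Mathlib.RingTheory.Nullstellensatz
import Mathlib.Algebra.Algebra.Hom.Rat
import HarnessLib

/-!
# A non-empty `Aut(ℂ/ℚ̄)`-stable locally closed algebraic subset of `ℂⁿ` has a point with algebraic coordinates

Topic `FieldTheory/AlgClosed`; a proofs-only sequel (theorems only, no definitions, no named facts)
of `AutFixedSubfield.lean` (the fixed field of `Aut(ℂ/F)` is `F`, `F ⊆ ℂ` countable) and
`AutStableSubspaceDescent.lean` (an `Aut(ℂ/F)`-stable subspace of `ℂⁿ` is spanned by `F`-rational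
vectors).  We run Weil's descent of `k`-closed sets (Lang, *Introduction to Algebraic Geometry*,
Ch. III §5, C4 ⟹ C7 in characteristic `0`) for `k = ℚ̄ ⊆ ℂ`, the field of algebraic numbers
(Mathlib `algebraicClosure ℚ ℂ`), together with Hilbert's Nullstellensatz over the algebraically
closed field `ℚ̄` (Mathlib `MvPolynomial.eq_vanishingIdeal_singleton_of_isMaximal`):

* `Complex.mem_span_algebraicCoeff_of_forall_ringEquiv` — **descent of `Aut(ℂ/ℚ̄)`-stable subspaces
  of a polynomial ring**: if a `ℂ`-subspace `J ⊆ ℂ[xᵢ | i ∈ ι]` is stable under the coefficientwise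
  action `F ↦ τF` of every automorphism `τ` of `ℂ` fixing the algebraic numbers, every `F ∈ J` is a
  `ℂ`-linear combination of members of `J` with ALGEBRAIC coefficients (apply the descent of stable
  subspaces of `ℂ^S`, `S` the support of `F`, to `{H ∈ J | supp H ⊆ S}`);
* `Complex.map_ringEquiv_mem_vanishingIdeal` — the vanishing ideal of an `Aut(ℂ/ℚ̄)`-stable subset
  of `ℂ^ι` is stable;
* `Complex.exists_algebraic_point_of_forall_ringEquiv` — **the theorem**: for ideals `I`, `J` of
  `ℂ[xᵢ | i ∈ ι]` (`ι` finite) such that the locally closed set `Z(I) ∖ Z(J) ⊆ ℂ^ι` and the closed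
  set `Z(J)` are both stable under `c ↦ τ ∘ c` for every automorphism `τ` of `ℂ` fixing the algebraic
  numbers, if `Z(I) ∖ Z(J)` is non-empty then it contains a point all of whose coordinates are
  algebraic over `ℚ`.  Proof: the vanishing ideals `𝔍₁ = I(Z(I) ∖ Z(J))`, `𝔍₂ = I(Z(J))` are stable,
  hence spanned by polynomials with algebraic coefficients; at a point `c⋆ ∈ Z(I) ∖ Z(J)` some such
  `g₀ ∈ 𝔍₂` does not vanish; the Rabinowitsch ideal `(𝔍₁ ∩ ℚ̄[x], 1 - y g₀) ⊆ ℚ̄[x, y]` has the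
  complex zero `(c⋆, 1/g₀(c⋆))`, hence is proper, hence (Nullstellensatz, `ℚ̄` algebraically closed)
  has a zero `(c₀, y₀) ∈ ℚ̄^{ι ⊔ 1}`; then `c₀ ∈ Z(𝔍₁) ∖ Z(𝔍₂) = Z(I) ∖ Z(J)`.

This is the arithmetic-descent input ("a non-empty `ℚ̄`-closed subset of `U(ℂ)` contains a point
with algebraic coefficients") of the fields-of-definition arguments for Hodge loci (Voisin, *Hodge
loci and absolute Hodge classes*, Compos. Math. 143 (2007), Lemma 1.4 and §3), consumed on the
`Summits` side by route `FiniteTreeOfFlavours` (crux `RigidImpliesQbar`).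

## References

* [Lang1958IAG] S. Lang, Introduction to Algebraic Geometry (1958), Ch. III §4 Thm. 9 and §5, C4–C7.
* [Lang2002] S. Lang, Algebra, rev. 3rd ed., GTM 211 (2002), Ch. VIII §1, Ch. IX §1 Thm. 1.5
  (Hilbert's Nullstellensatz).
* [Voisin2007HodgeLoci] C. Voisin, Hodge loci and absolute Hodge classes, Compos. Math. 143 (2007),
  945–958, Lemma 1.4.
-/

noncomputable section

open Cardinal MvPolynomial

namespace Literature.FieldTheory.AlgClosed

/-! ### The field of algebraic numbers inside `ℂ` -/

/-- The subfield `ℚ̄ ⊆ ℂ` of algebraic numbers is algebraic over `ℚ` (for the canonical `ℚ`-algebra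
structure of a field of characteristic zero). [folklore] -/
private theorem Complex.isAlgebraic_toSubfield_algebraicClosure :
    Algebra.IsAlgebraic ℚ ((algebraicClosure ℚ ℂ).toSubfield) := by
  refine ⟨fun x => ?_⟩
  have hx : IsAlgebraic ℚ (x : ℂ) := mem_algebraicClosure_iff.mp x.2
  exact (isAlgebraic_algHom_iff ((algebraicClosure ℚ ℂ).toSubfield.subtype.toRatAlgHom)
    Subtype.val_injective).mp hx

/-- The subfield `ℚ̄ ⊆ ℂ` of algebraic numbers is countable. [folklore] -/
private theorem Complex.cardinalMk_algebraicClosure_le_aleph0 :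
    #((algebraicClosure ℚ ℂ).toSubfield) ≤ ℵ₀ :=
  haveI := Complex.isAlgebraic_toSubfield_algebraicClosure
  Subfield.cardinalMk_le_aleph0_of_isAlgebraic _

/-- Membership in the subfield `ℚ̄ ⊆ ℂ` is algebraicity over `ℚ`. [folklore] -/
private theorem Complex.mem_toSubfield_algebraicClosure_iff {z : ℂ} :
    z ∈ (algebraicClosure ℚ ℂ).toSubfield ↔ IsAlgebraic ℚ z :=
  mem_algebraicClosure_iff

/-- **A complex number fixed by every automorphism of `ℂ` fixing the algebraic numbers is
algebraic** (the fixed field of `Aut(ℂ/ℚ̄)` is `ℚ̄`; `Complex.mem_subfield_of_forall_ringEquiv` for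
the countable subfield `ℚ̄`). [cite: Lang2002, Ch. VIII §1] -/
theorem Complex.isAlgebraic_of_forall_ringEquiv {z : ℂ}
    (h : ∀ τ : ℂ ≃+* ℂ, (∀ w : ℂ, IsAlgebraic ℚ w → τ w = w) → τ z = z) : IsAlgebraic ℚ z := by
  rw [← Complex.mem_toSubfield_algebraicClosure_iff]
  refine Complex.mem_subfield_of_forall_ringEquiv _ Complex.cardinalMk_algebraicClosure_le_aleph0
    fun σ hσ => h σ fun w hw => hσ w ?_
  exact Complex.mem_toSubfield_algebraicClosure_iff.mpr hw

/-! ### Descent of stable subspaces of a polynomial ring -/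

section Descent

variable {ι : Type*}

/-- Evaluating a coefficientwise-conjugated polynomial: `(τF)(c) = τ (F (τ⁻¹ ∘ c))`. [folklore] -/
private theorem Complex.eval_map_ringEquiv (τ : ℂ ≃+* ℂ) (c : ι → ℂ) (F : MvPolynomial ι ℂ) :
    eval c (MvPolynomial.map (τ : ℂ →+* ℂ) F) = τ (eval (⇑τ.symm ∘ c) F) := by
  rw [eval_map]
  change _ = (τ : ℂ →+* ℂ) (eval₂ (RingHom.id ℂ) (⇑τ.symm ∘ c) F)
  rw [eval₂_comp_left (τ : ℂ →+* ℂ)]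
  congr 1
  funext i
  simp

/-- **Descent of `Aut(ℂ/ℚ̄)`-stable subspaces of `ℂ[xᵢ | i ∈ ι]`**: if a `ℂ`-subspace `J` of the
polynomial ring is stable under the coefficientwise action of every automorphism of `ℂ` fixing the
algebraic numbers, then every `F ∈ J` lies in the `ℂ`-span of the members of `J` all of whose
coefficients are algebraic over `ℚ` (Borel's `k`-structures: apply
`Complex.submodule_le_span_fixed_of_forall_ringEquiv` on the finite support of `F`).
[cite: Lang1958IAG, Ch. III §5, C4–C7] -/
theorem Complex.mem_span_algebraicCoeff_of_forall_ringEquiv (J : Submodule ℂ (MvPolynomial ι ℂ))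
    (hJ : ∀ τ : ℂ ≃+* ℂ, (∀ z : ℂ, IsAlgebraic ℚ z → τ z = z) →
      ∀ F ∈ J, MvPolynomial.map (τ : ℂ →+* ℂ) F ∈ J)
    {F : MvPolynomial ι ℂ} (hF : F ∈ J) :
    F ∈ Submodule.span ℂ {H : MvPolynomial ι ℂ | H ∈ J ∧ ∀ e, IsAlgebraic ℚ (coeff e H)} := by
  classical
  -- the finite support of `F`, as an index type
  set S : Finset (ι →₀ ℕ) := F.support with hS
  -- coefficient vector on `S` and its section
  let φ : MvPolynomial ι ℂ →ₗ[ℂ] (S → ℂ) :=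
    { toFun := fun H e => coeff e.1 H
      map_add' := fun H H' => by funext e; simp
      map_smul' := fun a H => by funext e; simp }
  let ψ : (S → ℂ) →ₗ[ℂ] MvPolynomial ι ℂ :=
    { toFun := fun w => ∑ e : S, monomial e.1 (w e)
      map_add' := fun w w' => by simp [Finset.sum_add_distrib]
      map_smul' := fun a w => by simp [Finset.smul_sum, smul_monomial] }
  have hψφ : ∀ H : MvPolynomial ι ℂ, H.support ⊆ S → ψ (φ H) = H := by
    intro H hH
    change ∑ e : S, monomial e.1 (coeff e.1 H) = H
    rw [Finset.sum_coe_sort S (fun e => monomial e (coeff e H)),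
      ← Finset.sum_subset hH (fun e _ he => by rw [notMem_support_iff.mp he, monomial_zero])]
    exact H.as_sum.symm
  -- the stable subspace of `ℂ^S`
  let J' : Submodule ℂ (MvPolynomial ι ℂ) :=
    { carrier := {H | H ∈ J ∧ H.support ⊆ S}
      add_mem' := fun {a b} ha hb => ⟨J.add_mem ha.1 hb.1, (support_add).trans (Finset.union_subset ha.2 hb.2)⟩
      zero_mem' := ⟨J.zero_mem, by simp⟩
      smul_mem' := fun a H hH => ⟨J.smul_mem a hH.1, (support_smul).trans hH.2⟩ }
  let V : Submodule ℂ (S → ℂ) := J'.map φ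
  have hV : ∀ ρ : ℂ ≃+* ℂ, (∀ x ∈ (algebraicClosure ℚ ℂ).toSubfield, ρ x = x) →
      ∀ v ∈ V, (⇑ρ ∘ v) ∈ V := by
    intro ρ hρ v hv
    obtain ⟨H, ⟨hHJ, hHS⟩, rfl⟩ := hv
    have hρ' : ∀ z : ℂ, IsAlgebraic ℚ z → ρ z = z :=
      fun z hz => hρ z (Complex.mem_toSubfield_algebraicClosure_iff.mpr hz)
    refine ⟨MvPolynomial.map (ρ : ℂ →+* ℂ) H, ⟨hJ ρ hρ' H hHJ, (support_map_subset _ _).trans hHS⟩, ?_⟩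
    funext e
    simp [φ, coeff_map]
  have hle := Complex.submodule_le_span_fixed_of_forall_ringEquiv _
    Complex.cardinalMk_algebraicClosure_le_aleph0 V hV
  -- `φ F ∈ V`, hence in the span of the rational vectors of `V`
  have hφF : φ F ∈ V := ⟨F, ⟨hF, subset_rfl⟩, rfl⟩
  have hmem := hle hφF
  -- push forward along `ψ`
  have hF' : F = ψ (φ F) := (hψφ F subset_rfl).symm
  rw [hF']
  have h1 : ψ (φ F) ∈ Submodule.span ℂ
      (ψ '' {w : S → ℂ | w ∈ V ∧ ∀ i, w i ∈ (algebraicClosure ℚ ℂ).toSubfield}) := by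
    rw [Submodule.span_image]
    exact Submodule.mem_map_of_mem hmem
  refine Submodule.span_mono ?_ h1
  rintro _ ⟨w, ⟨hwV, hwalg⟩, rfl⟩
  obtain ⟨H, ⟨hHJ, hHS⟩, rfl⟩ := hwV
  rw [hψφ H hHS]
  refine ⟨hHJ, fun e => ?_⟩
  by_cases he : e ∈ S
  · exact Complex.mem_toSubfield_algebraicClosure_iff.mp (hwalg ⟨e, he⟩)
  · have h0 : coeff e H = 0 := notMem_support_iff.mp fun h => he (hHS h)
    rw [h0]
    exact isAlgebraic_zero

end Descent


/-! ### Vanishing ideals of stable sets; polynomials with algebraic coefficients -/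

section Vanishing

variable {ι : Type*}

/-- The vanishing ideal of a subset `C ⊆ ℂ^ι` stable under `c ↦ τ⁻¹ ∘ c` is stable under the
coefficientwise action `F ↦ τF` (`(τF)(c) = τ(F(τ⁻¹c))`). [folklore] -/
private theorem Complex.map_ringEquiv_mem_vanishingIdeal {C : Set (ι → ℂ)} (τ : ℂ ≃+* ℂ)
    (hC : ∀ c ∈ C, (⇑τ.symm ∘ c) ∈ C) {F : MvPolynomial ι ℂ} (hF : F ∈ vanishingIdeal ℂ C) :
    MvPolynomial.map (τ : ℂ →+* ℂ) F ∈ vanishingIdeal ℂ C := by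
  rw [mem_vanishingIdeal_iff] at hF ⊢
  intro c hc
  have h := hF _ (hC c hc)
  rw [aeval_eq_eval] at h ⊢
  rw [Complex.eval_map_ringEquiv, h, map_zero]

/-- An automorphism fixing the algebraic numbers has an inverse fixing the algebraic numbers.
[folklore] -/
private theorem Complex.ringEquiv_symm_apply_eq_of_isAlgebraic {τ : ℂ ≃+* ℂ}
    (hτ : ∀ z : ℂ, IsAlgebraic ℚ z → τ z = z) (z : ℂ) (hz : IsAlgebraic ℚ z) : τ.symm z = z := by
  conv_lhs => rw [← hτ z hz]
  exact τ.symm_apply_apply z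

/-- **A polynomial all of whose coefficients are algebraic comes from `ℚ̄[x]`**: it is the image of a
polynomial over the field of algebraic numbers under the coefficient map `ℚ̄ ⊆ ℂ`. [folklore] -/
private theorem Complex.exists_map_algebraMap_eq_of_forall_isAlgebraic {F : MvPolynomial ι ℂ}
    (hF : ∀ e, IsAlgebraic ℚ (coeff e F)) :
    ∃ F' : MvPolynomial ι (algebraicClosure ℚ ℂ),
      MvPolynomial.map (algebraMap (algebraicClosure ℚ ℂ) ℂ) F' = F := by
  classical
  refine ⟨∑ e ∈ F.support, monomial e ⟨coeff e F, mem_algebraicClosure_iff.mpr (hF e)⟩, ?_⟩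
  rw [map_sum]
  simp only [map_monomial]
  conv_rhs => rw [F.as_sum]
  rfl

/-- Evaluating at a point with coordinates in a subalgebra: `p(φ ∘ y) = φ(p(y))` for the structure
map `φ = algebraMap R A` and `p ∈ R[x]`. [folklore] -/
private theorem aeval_algebraMap_comp {R A : Type*} [CommSemiring R] [CommSemiring A] [Algebra R A]
    (y : ι → R) (p : MvPolynomial ι R) :
    aeval ((algebraMap R A) ∘ y) p = algebraMap R A (eval y p) := by
  rw [aeval_def, show eval y p = eval₂ (RingHom.id R) y p from rfl, eval₂_comp_left, RingHom.comp_id]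

end Vanishing

/-! ### The theorem: stable non-empty locally closed sets have algebraic points -/

section Main

variable {ι : Type*} [Finite ι]

/-- **A non-empty `Aut(ℂ/ℚ̄)`-stable locally closed algebraic subset of `ℂ^ι` has a point with
algebraic coordinates** (Weil's `k`-closed sets for `k = ℚ̄`: Lang, *Introduction to Algebraic
Geometry*, III §5, C4 ⟹ C7, with Hilbert's Nullstellensatz over `ℚ̄`). Let `I`, `J` be ideals of
`ℂ[xᵢ | i ∈ ι]`, `ι` finite, such that both the locally closed set `Z(I) ∖ Z(J)` and the closed set
`Z(J)` are stable under `c ↦ τ ∘ c` for every automorphism `τ` of `ℂ` fixing every algebraic number.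
If `Z(I) ∖ Z(J) ≠ ∅`, it contains a point all of whose coordinates are algebraic over `ℚ`.
[cite: Lang1958IAG, Ch. III §5, C4–C7] [cite: Lang2002, Ch. IX §1 Thm. 1.5] -/
theorem Complex.exists_algebraic_point_of_forall_ringEquiv (I J : Ideal (MvPolynomial ι ℂ))
    (hstab : ∀ τ : ℂ ≃+* ℂ, (∀ z : ℂ, IsAlgebraic ℚ z → τ z = z) →
      ∀ c ∈ zeroLocus ℂ I \ zeroLocus ℂ J, (⇑τ ∘ c) ∈ zeroLocus ℂ I \ zeroLocus ℂ J)
    (hJ : ∀ τ : ℂ ≃+* ℂ, (∀ z : ℂ, IsAlgebraic ℚ z → τ z = z) →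
      ∀ c ∈ zeroLocus ℂ J, (⇑τ ∘ c) ∈ zeroLocus ℂ J)
    (hne : (zeroLocus ℂ I \ zeroLocus ℂ J).Nonempty) :
    ∃ c ∈ zeroLocus ℂ I \ zeroLocus ℂ J, ∀ i, IsAlgebraic ℚ (c i) := by
  classical
  set C := zeroLocus ℂ I \ zeroLocus ℂ J with hCdef
  -- the two stable vanishing ideals
  set J₁ : Ideal (MvPolynomial ι ℂ) := vanishingIdeal ℂ C with hJ₁def
  set J₂ : Ideal (MvPolynomial ι ℂ) := vanishingIdeal ℂ (zeroLocus ℂ J) with hJ₂def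
  have hJ₁ : ∀ τ : ℂ ≃+* ℂ, (∀ z : ℂ, IsAlgebraic ℚ z → τ z = z) →
      ∀ F ∈ J₁, MvPolynomial.map (τ : ℂ →+* ℂ) F ∈ J₁ := fun τ hτ F hF =>
    Complex.map_ringEquiv_mem_vanishingIdeal τ
      (fun c hc => hstab τ.symm (Complex.ringEquiv_symm_apply_eq_of_isAlgebraic hτ) c hc) hF
  have hJ₂ : ∀ τ : ℂ ≃+* ℂ, (∀ z : ℂ, IsAlgebraic ℚ z → τ z = z) →
      ∀ F ∈ J₂, MvPolynomial.map (τ : ℂ →+* ℂ) F ∈ J₂ := fun τ hτ F hF =>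
    Complex.map_ringEquiv_mem_vanishingIdeal τ
      (fun c hc => hJ τ.symm (Complex.ringEquiv_symm_apply_eq_of_isAlgebraic hτ) c hc) hF
  -- descent: both are spanned by polynomials with algebraic coefficients
  have hd₁ : ∀ F ∈ J₁, F ∈ Submodule.span ℂ
      {H : MvPolynomial ι ℂ | H ∈ J₁ ∧ ∀ e, IsAlgebraic ℚ (coeff e H)} := fun F hF =>
    Complex.mem_span_algebraicCoeff_of_forall_ringEquiv (J₁.restrictScalars ℂ) hJ₁ hF
  have hd₂ : ∀ F ∈ J₂, F ∈ Submodule.span ℂ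
      {H : MvPolynomial ι ℂ | H ∈ J₂ ∧ ∀ e, IsAlgebraic ℚ (coeff e H)} := fun F hF =>
    Complex.mem_span_algebraicCoeff_of_forall_ringEquiv (J₂.restrictScalars ℂ) hJ₂ hF
  -- a point `c⋆` of `C` and a polynomial `g₀ ∈ J₂` with algebraic coefficients not vanishing there
  obtain ⟨cs, hcs⟩ := hne
  obtain ⟨g₀, hg₀J₂, hg₀alg, hg₀cs⟩ : ∃ g₀ ∈ J₂, (∀ e, IsAlgebraic ℚ (coeff e g₀)) ∧
      aeval cs g₀ ≠ 0 := by
    by_contra hcon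
    push Not at hcon
    refine hcs.2 ((mem_zeroLocus_iff).mpr fun p hp => ?_)
    have hle : Submodule.span ℂ {H : MvPolynomial ι ℂ | H ∈ J₂ ∧ ∀ e, IsAlgebraic ℚ (coeff e H)} ≤
        LinearMap.ker (aeval cs : MvPolynomial ι ℂ →ₐ[ℂ] ℂ).toLinearMap :=
      Submodule.span_le.mpr fun H hH => hcon H hH.1 hH.2
    exact hle (hd₂ p (le_vanishingIdeal_zeroLocus J hp))
  -- lifts to `ℚ̄[x]` of the polynomials with algebraic coefficients
  set K₀ := algebraicClosure ℚ ℂ with hK₀def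
  have hlift : ∀ F : MvPolynomial ι ℂ, ∃ F' : MvPolynomial ι K₀, (∀ e, IsAlgebraic ℚ (coeff e F)) →
      MvPolynomial.map (algebraMap K₀ ℂ) F' = F := fun F => by
    by_cases h : ∀ e, IsAlgebraic ℚ (coeff e F)
    · obtain ⟨F', hF'⟩ := Complex.exists_map_algebraMap_eq_of_forall_isAlgebraic h
      exact ⟨F', fun _ => hF'⟩
    · exact ⟨0, fun h' => absurd h' h⟩
  choose lift hlift using hlift
  haveI : IsAlgClosed K₀ := (algebraicClosure.isAlgClosure ℚ ℂ).isAlgClosed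
  -- the Rabinowitsch ideal over `ℚ̄` in the variables `ι ⊔ {y}`
  set gens : Set (MvPolynomial (Option ι) K₀) :=
    (fun H => rename some (lift H)) '' {H : MvPolynomial ι ℂ | H ∈ J₁ ∧ ∀ e, IsAlgebraic ℚ (coeff e H)}
      ∪ {1 - X none * rename some (lift g₀)} with hgens
  set 𝔞 : Ideal (MvPolynomial (Option ι) K₀) := Ideal.span gens with h𝔞def
  -- it has the complex zero `(c⋆, 1/g₀(c⋆))`, hence is proper
  have h𝔞 : 𝔞 ≠ ⊤ := by
    intro htop
    let pt : Option ι → ℂ := fun o => o.elim (aeval cs g₀)⁻¹ cs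
    have hpt : (pt ∘ some) = cs := rfl
    have hker : ∀ p ∈ gens, aeval pt p = 0 := by
      rintro p (⟨H, ⟨hHJ₁, hHalg⟩, rfl⟩ | hp)
      · rw [aeval_rename, hpt, ← aeval_map_algebraMap ℂ cs (lift H), hlift H hHalg]
        exact (mem_vanishingIdeal_iff.mp hHJ₁) cs hcs
      · rw [Set.mem_singleton_iff] at hp
        subst hp
        rw [map_sub, map_one, map_mul, aeval_X, aeval_rename, hpt,
          ← aeval_map_algebraMap ℂ cs (lift g₀), hlift g₀ hg₀alg]
        change (1 : ℂ) - (aeval cs g₀)⁻¹ * aeval cs g₀ = 0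
        rw [inv_mul_cancel₀ hg₀cs, sub_self]
    have hle : 𝔞 ≤ RingHom.ker (aeval pt : MvPolynomial (Option ι) K₀ →ₐ[K₀] ℂ) :=
      Ideal.span_le.mpr fun p hp => hker p hp
    have h1 : aeval pt (1 : MvPolynomial (Option ι) K₀) = 0 := hle (htop ▸ Submodule.mem_top)
    rw [map_one] at h1
    exact one_ne_zero h1
  -- Nullstellensatz over `ℚ̄`: a `ℚ̄`-point of the Rabinowitsch ideal
  obtain ⟨𝔪, h𝔪, h𝔞𝔪⟩ := Ideal.exists_le_maximal 𝔞 h𝔞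
  obtain ⟨x, hx⟩ := MvPolynomial.eq_vanishingIdeal_singleton_of_isMaximal K₀ h𝔪
  have hvan : ∀ p ∈ gens, aeval x p = 0 := fun p hp => by
    have hp𝔪 : p ∈ 𝔪 := h𝔞𝔪 (Ideal.subset_span hp)
    rw [hx, mem_vanishingIdeal_singleton_iff] at hp𝔪
    exact hp𝔪
  -- the algebraic point
  let c₀ : ι → ℂ := (algebraMap K₀ ℂ) ∘ (x ∘ some)
  have heval : ∀ H : MvPolynomial ι ℂ, (∀ e, IsAlgebraic ℚ (coeff e H)) →
      aeval c₀ H = algebraMap K₀ ℂ (eval (x ∘ some) (lift H)) := fun H hH => by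
    conv_lhs => rw [← hlift H hH, aeval_map_algebraMap ℂ c₀ (lift H)]
    exact aeval_algebraMap_comp (x ∘ some) (lift H)
  refine ⟨c₀, ⟨?_, ?_⟩, fun i => ?_⟩
  · -- `c₀ ∈ Z(I)`: every member of `J₁ ⊇ I` vanishes at `c₀`
    have hrat : ∀ H ∈ J₁, (∀ e, IsAlgebraic ℚ (coeff e H)) → aeval c₀ H = 0 := by
      intro H hH hHalg
      have h := hvan _ (Or.inl ⟨H, ⟨hH, hHalg⟩, rfl⟩)
      rw [aeval_rename, aeval_eq_eval] at h
      rw [heval H hHalg, h, map_zero]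
    have hall : ∀ F ∈ J₁, aeval c₀ F = 0 := fun F hF => by
      have hle : Submodule.span ℂ {H : MvPolynomial ι ℂ | H ∈ J₁ ∧ ∀ e, IsAlgebraic ℚ (coeff e H)} ≤
          LinearMap.ker (aeval c₀ : MvPolynomial ι ℂ →ₐ[ℂ] ℂ).toLinearMap :=
        Submodule.span_le.mpr fun H hH => hrat H hH.1 hH.2
      exact hle (hd₁ F hF)
    exact (mem_zeroLocus_iff).mpr fun p hp =>
      hall p (vanishingIdeal_anti_mono Set.sdiff_subset (le_vanishingIdeal_zeroLocus I hp))
  · -- `c₀ ∉ Z(J)`: `g₀ ∈ J₂` does not vanish at `c₀`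
    intro hc₀J
    have h0 : aeval c₀ g₀ = 0 := (mem_vanishingIdeal_iff.mp hg₀J₂) c₀ hc₀J
    have h1 := hvan _ (Or.inr rfl)
    rw [map_sub, map_one, map_mul, aeval_X, aeval_rename, aeval_eq_eval, sub_eq_zero] at h1
    rw [heval g₀ hg₀alg, map_eq_zero_iff _ (algebraMap K₀ ℂ).injective] at h0
    rw [h0, mul_zero] at h1
    exact one_ne_zero h1
  · exact mem_algebraicClosure_iff.mp (x (some i)).2

end Main

end Literature.FieldTheory.AlgClosed

end
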